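import Literature.MathematicalPhysics.QuantumFieldTheory.Balaban1983to89.B6MultiLevelBoxOperator

/-!
# `Balaban1983to89.B6MultiLevelTorusOperator` — [B6] (2.1)–(2.4), (2.13)–(2.14) ON THE TORUS `T_η`: the GENUINE
`k`-LEVEL operator `Δ′_a = −Δ^{per} + Σ_{j=1}^{k} a_j(L^jη)^{−2}Q′_j*1_{Λ_j}Q′_j` on print's carrier (a discrete torus,
`Ω₁ = T_η`), its positivity and inverse `G′ = Δ′_a⁻¹`, and the TRANSLATION CHARTS which make every row of the torus
problem a row of the Neumann-box problem of the lineage (`B6MultiLevelBoxOperator` … `B6Prop22MultiLevelBox`,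
consumed BY NAME; no existing module is touched; no fact is minted) — file T1 of the torus carrier of the multi-level
parametrix of p. 229–234

FRAMING (verbatim cell line):
statement-level skeleton of published theorems with citation tags; proofs where landed; nothing here is a claim about the Yang–Mills mass gap

Source under audit (cell pub-balaban / lit-balaban): T. Bałaban, *Propagators and renormalization transformations for
lattice gauge theories. II*, Commun. Math. Phys. **96** (1984) 223–250 [`Balaban1984PropagatorsII`, "B6"], p. 224 [PDF 2]
(2.1)–(2.4), p. 225 [PDF 3] (2.13)–(2.14) (held text `paper:balaban1984-cmp96-propagators-rt-ii`, p0002/p0003 read this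
generation); T. Bałaban, *Regularity and decay of lattice Green's functions*, Commun. Math. Phys. **89** (1983) 571–597
[`Balaban1983RegularityDecay`, "[3]"], p. 572 [PDF 2] (the torus sentence).  Unit `lit-balaban-p21` (Phase-2 proof seat
p21 gen 15, HOME `run/shared/lean/pub/lit-balaban/`, free-target protocol G.5-34(d), B6 fold owner r03 — whose stated
preference «torus carrier» this programme serves —, referee ref-4).

## WHAT IS PRINTED (verbatim up to notation)

p. 224: «We consider a sequence of domains Ω₁ ⊃ Ω₂ ⊃ … ⊃ Ω_k, Ω_j ⊂ T_η, j = 1, 2, …, k, (2.1) which satisfy the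
following conditions: Ω_j = B^j(Ω_j^{(j)}), Ω_j^{(j)} ⊂ T^{(j)}_{L^jη} and it is a sum of big blocks,
(L^jη)^{−1}dist(Ω_j^c, Ω_{j+1}) > RM, M is a size of big blocks and R is a big positive integer which will be fixed later.
(2.2) … The above sets are subsets of T_η … Let us notice that we admit the case when some domains Ω_j are equal to T_η, for
example Ω_j = T_η for j = 1, 2, …, l, l ≤ k.»  p. 225: «Δ′_a = Δ + Q′*aQ′ and the operator Q′*aQ′ is given by the quadratic
form ⟨λ, Q′*aQ′λ⟩ = Σ_{j=0}^{k} Σ_{y∈Λ_j} a_j(L^jη)^{d−2}|(Q′_jλ)(y)|². (2.14) … The operator G′ = Δ′_a^{−1} is a well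
defined, positive operator».  [3] p. 572: «Another common case is to consider operators on subsets of a torus T_η which we
identify with a rectangular parallelepiped in ηZ^d with periodic conditions.»

## WHAT THIS FILE CERTIFIES (kernel-checked; lattice units of the lineage, `η = 1`)

The torus `T_η` is «identified with a rectangular parallelepiped with periodic conditions»: its sites are the sites of the
fundamental box `X = Π_μ[0, N₀_μ)` of the lineage (`boxDom (N0 ℓ M_h k P)`, `N₀_μ = L^k·L·M_h·P_μ = (M·L^k)·P_μ`), so that
every matrix of the box lineage is a matrix on the torus sites.
* §1 `twrap`, **`tshift N t : X ≃ X`** — the torus translation `x ↦ (x + t) mod N₀` (group law `tshift_tshift`, no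
  wrap-around off the walls `tshift_val_of_mem`, `torusSupNorm_tshift_sub`: the torus distance is translation invariant).
* §2 **`perLapT = −Δ^{per} = Σ_μ(2 − S_{e_μ} − S_{−e_μ})`** (shift matrices `shiftMat`), its form
  `⟨f, −Δ^{per}f⟩ = Σ_μΣ_x(f(x) − f(x+e_μ))²` (`perLapT_form`, every torus bond once), symmetry, translation invariance
  (`perLapT_tshift`); **off the walls `−Δ^{per}` IS the Neumann Laplacian `−Δ^N_X` of the lineage** (`perLapT_apply_of_interior`),
  so the **seam matrix** `seamT = −Δ^{per} − (−Δ^N_X)` lives on the wall rows and columns (`seamT_apply_of_interior_left/right`)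
  and annihilates every matrix with vanishing wall rows (`seamT_mul_eq_zero`).
* §3 block arithmetic of translations by multiples of the block size (`emod_mul_ediv`, `blk_twrap_add`, `blk_tshift_eq_iff`:
  `x′ ∼_b x ⇔ σ_t x′ ∼_b σ_t x` for `b ∣ t`, `b ∣ N₀`).
* §4 **`TDomains` — (2.1)–(2.2) ON THE TORUS AS A STRUCTURE**: the level function (`x ∈ B^j(Λ_j) ⇔ lev x = j`, levels
  `1 … k`, `Ω₁ = T_η`), (2.1) big blocks, **(2.2) with the TORUS sup-distance** `dist_T(Ω_j^c, Ω_{j+1}) > R·M·L^j`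
  (`torusSupNorm` of `B4TorusKernel`); `toDomains` (a torus family IS a box family of the fundamental box, since
  `dist_T ≤ dist_X`: every theorem of the box lineage applies), `top` (inhabited), and **the charts** `D.chart s`
  (the family translated by `(M·L^k)·s` is again a torus family: big blocks go to big blocks, torus distances are kept;
  `chart_lev`: `(D.chart s).lev x = D.lev(σ_s x)`).
* §5 **`mlOpT` — THE GENUINE `k`-LEVEL OPERATOR `Δ′_a` ON THE TORUS** (`= mlOp + seamT = −Δ^{per} + Σ_j a_jL^{−2j}Q′_j*1_{Λ_j}Q′_j`,
  `mlOpT_eq`, entries `mlOpT_apply`), its quadratic form (`mlOpT_form`), **injectivity** (`mlOpT_mulVec_injective`: zero torus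
  bond form ⇒ constant ⇒ killed by the block form — print's «G′ = Δ′_a^{−1} is a well defined, positive operator»), the inverse
  **`gmlT = G′`** with `Δ′_aG′ = G′Δ′_a = 1`, symmetry and positivity (`gmlT_form_nonneg`).
* §6 **THE CHART IDENTITY** `mlOpT_tshift` / `mlOpT_eq_reindex_chart`: `Δ′_a^{torus}(σ_s x, σ_s y) = Δ′_a^{torus, chart s}(x, y)`,
  i.e. `Δ′_a^{torus} = σ_s ∘ (Δ′_a^{box}[(D.chart s).toDomains] + seamT) ∘ σ_s⁻¹`; hence (`mlOpT_mul_reindex`) for every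
  matrix `A` with vanishing wall rows `Δ′_a^{torus}·(σ_sAσ_s⁻¹) = σ_s(Δ′_a^{box,s}·A)σ_s⁻¹` — the device by which the files
  to follow transport the cube terms of (2.37)–(2.38), the bounds (2.44)/(2.49)/(2.64) and Prop. 2.2 from the box lineage to
  print's torus, one chart per cube.

## HONEST SCOPE

* The torus has the side lengths `N₀_μ = (M·L^k)·P_μ` of the lineage's box (print's `T_η` has `L^k` times the unit torus per
  direction; `P_μ` is free); levels `1 … k` with `Ω₁ = T_η` — EXACTLY print's admitted case «Ω_j = T_η for j = 1, …, l»
  with `l ≥ 1` (print's level `0`, `Λ₀ = T_η ∖ Ω₁` with `λ = 0` there, is empty in this case); `A = 0` (no gauge field in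
  §2.B); `m² = 0`; the weights `a_j` are free positive parameters (print's `a_j = B1.aSeq a L j`, `aPrinted` of the lineage).
* `dist` of (2.2) read in the sup-distance of the torus `Π_μ ℤ/N₀_μ` (print does not fix the norm); big blocks of level `j`
  = the cubes of the grid `(M·L^j)ℤ^{d+1}` reduced modulo `N₀` (`M·L^j ∣ N₀_μ`).
* This file proves no inequality of Prop. 2.2; it sets up the carrier, the operator, its inverse and the charts.  Nothing is
  inferred from the manuscript: every step is kernel-checked; the quoted sentences locate the statements.

DOCFIX (referee ref-4 NOTE S-B6-g54-1, «Gen 55»): the p. 224 sentence is quoted as printed («We consider a sequence of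
domains …»); no declaration changed.
-/

namespace Literature.MathematicalPhysics.QuantumFieldTheory.Balaban1983to89.B6MultiLevelTorusOperator

open Finset Matrix
open Literature.MathematicalPhysics.QuantumFieldTheory.Balaban1983to89.B4ContourShift (supNorm abs_le_supNorm
  supNorm_nonneg exists_supNorm_eq)
open Literature.MathematicalPhysics.QuantumFieldTheory.Balaban1983to89.B4Reflection242 (boxDom mem_boxDom nbrs mem_nbrs
  blk neumannLapK diagK avgK card_nbrs not_mem_nbrs_self)
open Literature.MathematicalPhysics.QuantumFieldTheory.Balaban1983to89.B4Green242Bridge (boxNbrs zero_mem_boxDom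
  box_const_of_bonds mem_boxNbrs_comm not_mem_boxNbrs_self card_boxNbrs)
open Literature.MathematicalPhysics.QuantumFieldTheory.Balaban1983to89.B4BoxCov237 (opBoxR opBoxR_isSymm quadFormR_eq)
open Literature.MathematicalPhysics.QuantumFieldTheory.Balaban1983to89.B4TorusKernel.MultiPeriod (torusSupNorm translate
  torusSupNorm_le_supNorm torusSupNorm_translate translate_apply)
open Literature.MathematicalPhysics.QuantumFieldTheory.Balaban1983to89.B6MultiLevelBoxOperator

noncomputable section

variable {d : ℕ}

/-! ## §1 Torus translations of the fundamental box `Π_μ[0, N_μ)` -/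

/-- reduction modulo the periods: `twrap N z = (z_μ mod N_μ)_μ`. [cite: Balaban1983RegularityDecay, p.572 («a torus T_η … with periodic conditions»), dictionary] -/
def twrap (N : Fin (d + 1) → ℕ) (z : Fin (d + 1) → ℤ) : Fin (d + 1) → ℤ := fun i => z i % (N i : ℤ)

/-- the periods of an inhabited box are positive. [cite: Balaban1983RegularityDecay, p.572 («a torus T_η … with periodic conditions»), dictionary] -/
theorem one_le_of_mem {N : Fin (d + 1) → ℕ} {x : Fin (d + 1) → ℤ} (hx : x ∈ boxDom N) (i : Fin (d + 1)) : 1 ≤ N i := by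
  have h := (mem_boxDom.1 hx) i
  have : (0 : ℤ) < N i := lt_of_le_of_lt h.1 h.2
  exact_mod_cast this

/-- the reduction lies in the box. [cite: Balaban1983RegularityDecay, p.572 («a torus T_η … with periodic conditions»), dictionary] -/
theorem twrap_mem {N : Fin (d + 1) → ℕ} (hN : ∀ i, 1 ≤ N i) (z : Fin (d + 1) → ℤ) : twrap N z ∈ boxDom N :=
  mem_boxDom.2 fun i => by
    have h : (0 : ℤ) < N i := by exact_mod_cast hN i
    exact ⟨Int.emod_nonneg _ h.ne', Int.emod_lt_of_pos _ h⟩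

/-- box points are their own reductions. [cite: Balaban1983RegularityDecay, p.572 («a torus T_η … with periodic conditions»), dictionary] -/
theorem twrap_eq_self {N : Fin (d + 1) → ℕ} {z : Fin (d + 1) → ℤ} (hz : z ∈ boxDom N) : twrap N z = z :=
  funext fun i => Int.emod_eq_of_lt ((mem_boxDom.1 hz) i).1 ((mem_boxDom.1 hz) i).2

/-- `((z mod N) + v) mod N = (z + v) mod N`. [cite: Balaban1983RegularityDecay, p.572 («a torus T_η … with periodic conditions»), dictionary] -/
theorem twrap_twrap_add (N : Fin (d + 1) → ℕ) (z v : Fin (d + 1) → ℤ) : twrap N (twrap N z + v) = twrap N (z + v) :=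
  funext fun i => by simp only [twrap, Pi.add_apply]; exact Int.emod_add_emod _ _ _

/-- `z mod N` is the translate of `z` by the period vector `−⌊z/N⌋`. [cite: Balaban1983RegularityDecay, p.572 («a torus T_η … with periodic conditions»), dictionary] -/
theorem twrap_eq_translate (N : Fin (d + 1) → ℕ) (z : Fin (d + 1) → ℤ) :
    twrap N z = translate N z (fun i => -(z i / N i)) := by
  funext i
  rw [translate_apply]
  show z i % (N i : ℤ) = z i + N i * -(z i / N i)
  linarith [Int.mul_ediv_add_emod (z i) (N i)]

/-- the reduction is invariant under period translates. [cite: Balaban1983RegularityDecay, p.572 («a torus T_η … with periodic conditions»), dictionary] -/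
theorem twrap_translate (N : Fin (d + 1) → ℕ) (z m : Fin (d + 1) → ℤ) : twrap N (translate N z m) = twrap N z :=
  funext fun i => by simp only [twrap, translate_apply]; exact Int.add_mul_emod_self_left _ _ _

/-- **TORUS TRANSLATION BY `t`** as a permutation of the fundamental box: `x ↦ (x + t) mod N` («a rectangular
parallelepiped … with periodic conditions»). [cite: Balaban1983RegularityDecay, p.572 («a torus T_η which we identify with a rectangular parallelepiped in ηZ^d with periodic conditions»), dictionary] -/
def tshift (N : Fin (d + 1) → ℕ) (t : Fin (d + 1) → ℤ) : ↥(boxDom N) ≃ ↥(boxDom N) where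
  toFun x := ⟨twrap N (x.1 + t), twrap_mem (one_le_of_mem x.2) _⟩
  invFun x := ⟨twrap N (x.1 - t), twrap_mem (one_le_of_mem x.2) _⟩
  left_inv x := by
    apply Subtype.ext
    show twrap N (twrap N (x.1 + t) - t) = x.1
    rw [sub_eq_add_neg, twrap_twrap_add, add_neg_cancel_right, twrap_eq_self x.2]
  right_inv x := by
    apply Subtype.ext
    show twrap N (twrap N (x.1 - t) + t) = x.1
    rw [twrap_twrap_add, sub_add_cancel, twrap_eq_self x.2]

/-- the value of a translated point. [cite: Balaban1983RegularityDecay, p.572 («a torus T_η … with periodic conditions»), dictionary] -/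
theorem tshift_val (N : Fin (d + 1) → ℕ) (t : Fin (d + 1) → ℤ) (x : ↥(boxDom N)) :
    (tshift N t x).1 = twrap N (x.1 + t) := rfl

/-- the inverse translation is the translation by `−t`. [cite: Balaban1983RegularityDecay, p.572 («a torus T_η … with periodic conditions»), dictionary] -/
theorem tshift_symm_apply (N : Fin (d + 1) → ℕ) (t : Fin (d + 1) → ℤ) (x : ↥(boxDom N)) :
    (tshift N t).symm x = tshift N (-t) x := by
  apply Subtype.ext
  show twrap N (x.1 - t) = twrap N (x.1 + -t)
  rw [sub_eq_add_neg]

/-- translations compose additively. [cite: Balaban1983RegularityDecay, p.572 («a torus T_η … with periodic conditions»), dictionary] -/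
theorem tshift_tshift (N : Fin (d + 1) → ℕ) (s t : Fin (d + 1) → ℤ) (x : ↥(boxDom N)) :
    tshift N s (tshift N t x) = tshift N (t + s) x := by
  apply Subtype.ext
  show twrap N (twrap N (x.1 + t) + s) = twrap N (x.1 + (t + s))
  rw [twrap_twrap_add, add_assoc]

/-- the translation by `0` is the identity. [cite: Balaban1983RegularityDecay, p.572 («a torus T_η … with periodic conditions»), dictionary] -/
theorem tshift_zero (N : Fin (d + 1) → ℕ) (x : ↥(boxDom N)) : tshift N 0 x = x := by
  apply Subtype.ext
  show twrap N (x.1 + 0) = x.1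
  rw [add_zero, twrap_eq_self x.2]

/-- no wrap-around: if `x + t` lies in the box, the translate is `x + t`. [cite: Balaban1983RegularityDecay, p.572 («a torus T_η … with periodic conditions»), dictionary] -/
theorem tshift_val_of_mem {N : Fin (d + 1) → ℕ} {t : Fin (d + 1) → ℤ} {x : ↥(boxDom N)} (h : x.1 + t ∈ boxDom N) :
    (tshift N t x).1 = x.1 + t := by
  rw [tshift_val, twrap_eq_self h]

/-- a translated point is a period translate of `x + t`. [cite: Balaban1983RegularityDecay, p.572 («a torus T_η … with periodic conditions»), dictionary] -/
theorem tshift_val_eq_translate (N : Fin (d + 1) → ℕ) (t : Fin (d + 1) → ℤ) (x : ↥(boxDom N)) :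
    ∃ m, (tshift N t x).1 = translate N (x.1 + t) m :=
  ⟨_, by rw [tshift_val, twrap_eq_translate]⟩

/-- differences of translated points are period translates of the differences. [cite: Balaban1983RegularityDecay, p.572 («a torus T_η … with periodic conditions»), dictionary] -/
theorem tshift_sub_tshift (N : Fin (d + 1) → ℕ) (t : Fin (d + 1) → ℤ) (x y : ↥(boxDom N)) :
    ∃ m, (tshift N t x).1 - (tshift N t y).1 = translate N (x.1 - y.1) m := by
  obtain ⟨m₁, h₁⟩ := tshift_val_eq_translate N t x
  obtain ⟨m₂, h₂⟩ := tshift_val_eq_translate N t y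
  refine ⟨m₁ - m₂, ?_⟩
  rw [h₁, h₂]
  funext i
  simp only [Pi.sub_apply, translate_apply, Pi.add_apply]
  ring

/-- **THE TORUS DISTANCE IS TRANSLATION INVARIANT**: `|σ_t x − σ_t y|_T = |x − y|_T`. [cite: Balaban1983RegularityDecay, p.572 («a torus T_η … with periodic conditions»), dictionary] -/
theorem torusSupNorm_tshift_sub (N : Fin (d + 1) → ℕ) (t : Fin (d + 1) → ℤ) (x y : ↥(boxDom N)) :
    torusSupNorm N ((tshift N t x).1 - (tshift N t y).1) = torusSupNorm N (x.1 - y.1) := by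
  obtain ⟨m, hm⟩ := tshift_sub_tshift N t x y
  rw [hm, torusSupNorm_translate]

/-! ## §2 The periodic Laplacian `−Δ^{per}` of the torus `T = Π_μ ℤ/N_μ` on the fundamental box -/

section PerLap

variable (N : Fin (d + 1) → ℕ)

/-- the unit vector `e_μ`. [cite: Balaban1983RegularityDecay, p.572 («a torus T_η … with periodic conditions»), dictionary] -/
def unitVec (μ : Fin (d + 1)) : Fin (d + 1) → ℤ := Pi.single μ 1

/-- the permutation matrix of the torus translation by `v`: `(S_v f)(x) = f(σ_v x)`. [cite: Balaban1983RegularityDecay, p.572 («a torus T_η … with periodic conditions»), dictionary] -/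
def shiftMat (v : Fin (d + 1) → ℤ) : Matrix ↥(boxDom N) ↥(boxDom N) ℝ :=
  fun x y => if y = tshift N v x then 1 else 0

/-- `(S_v f)(x) = f(σ_v x)`. [cite: Balaban1983RegularityDecay, p.572 («a torus T_η … with periodic conditions»), dictionary] -/
theorem shiftMat_mulVec (v : Fin (d + 1) → ℤ) (f : ↥(boxDom N) → ℝ) (x : ↥(boxDom N)) :
    (shiftMat N v *ᵥ f) x = f (tshift N v x) := by
  classical
  unfold shiftMat Matrix.mulVec dotProduct
  simp only [ite_mul, one_mul, zero_mul, Finset.sum_ite_eq', Finset.mem_univ, if_true]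

/-- `S_{−v} = S_vᵀ`. [cite: Balaban1983RegularityDecay, p.572 («a torus T_η … with periodic conditions»), dictionary] -/
theorem shiftMat_neg (v : Fin (d + 1) → ℤ) : shiftMat N (-v) = (shiftMat N v)ᵀ := by
  ext x y
  simp only [shiftMat, Matrix.transpose_apply]
  have h : (y = tshift N (-v) x) ↔ (x = tshift N v y) := by
    constructor
    · intro h; rw [h, tshift_tshift, neg_add_cancel, tshift_zero]
    · intro h; rw [h, tshift_tshift, add_neg_cancel, tshift_zero]
  by_cases hxy : y = tshift N (-v) x
  · rw [if_pos hxy, if_pos (h.1 hxy)]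
  · rw [if_neg hxy, if_neg (fun h' => hxy (h.2 h'))]

/-- **THE PERIODIC LAPLACIAN** `−Δ^{per} = Σ_μ (2 − S_{e_μ} − S_{−e_μ})` on the fundamental box of the torus (lattice
units). [cite: Balaban1983RegularityDecay, (1.3) p.572 with «periodic conditions», dictionary] -/
def perLapT : Matrix ↥(boxDom N) ↥(boxDom N) ℝ :=
  ∑ μ : Fin (d + 1), ((2 : ℝ) • (1 : Matrix ↥(boxDom N) ↥(boxDom N) ℝ) - shiftMat N (unitVec μ) - shiftMat N (-unitVec μ))

/-- `(−Δ^{per}f)(x) = Σ_μ (2f(x) − f(x + e_μ) − f(x − e_μ))` (torus neighbours). [cite: Balaban1983RegularityDecay, (1.3) p.572, dictionary] -/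
theorem perLapT_mulVec (f : ↥(boxDom N) → ℝ) (x : ↥(boxDom N)) :
    (perLapT N *ᵥ f) x = ∑ μ, (2 * f x - f (tshift N (unitVec μ) x) - f (tshift N (-unitVec μ) x)) := by
  unfold perLapT
  rw [Matrix.sum_mulVec, Finset.sum_apply]
  refine Finset.sum_congr rfl fun μ _ => ?_
  rw [Matrix.sub_mulVec, Matrix.sub_mulVec, Pi.sub_apply, Pi.sub_apply, shiftMat_mulVec, shiftMat_mulVec,
    Matrix.smul_mulVec, Matrix.one_mulVec, Pi.smul_apply, smul_eq_mul]

/-- `−Δ^{per}` is symmetric. [cite: Balaban1983RegularityDecay, (1.3) p.572, dictionary] -/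
theorem perLapT_isSymm : (perLapT N).IsSymm := by
  unfold Matrix.IsSymm perLapT
  rw [Matrix.transpose_sum]
  refine Finset.sum_congr rfl fun μ _ => ?_
  rw [Matrix.transpose_sub, Matrix.transpose_sub, Matrix.transpose_smul, Matrix.transpose_one, ← shiftMat_neg,
    ← shiftMat_neg, neg_neg]
  abel

/-- **THE QUADRATIC FORM OF `−Δ^{per}`**: `⟨f, −Δ^{per}f⟩ = Σ_μ Σ_x (f(x) − f(x + e_μ))²` — every torus bond counted once
(«Σ_{b⊂Ω} |(∂f)(b)|²» with periodic conditions). [cite: Balaban1983RegularityDecay, (1.3) p.572, dictionary] -/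
theorem perLapT_form (f : ↥(boxDom N) → ℝ) :
    f ⬝ᵥ perLapT N *ᵥ f = ∑ μ, ∑ x, (f x - f (tshift N (unitVec μ) x)) ^ 2 := by
  unfold dotProduct
  simp_rw [perLapT_mulVec, Finset.mul_sum]
  rw [Finset.sum_comm]
  refine Finset.sum_congr rfl fun μ _ => ?_
  -- reindex the backward term along the bijection `σ_{e_μ}`
  have hre : ∑ x, f x * f (tshift N (-unitVec μ) x) = ∑ x, f (tshift N (unitVec μ) x) * f x := by
    rw [← Equiv.sum_comp (tshift N (unitVec μ)) (fun x => f x * f (tshift N (-unitVec μ) x))]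
    refine Finset.sum_congr rfl fun x _ => ?_
    rw [tshift_tshift, add_neg_cancel, tshift_zero]
  have hsq : ∑ x, f (tshift N (unitVec μ) x) ^ 2 = ∑ x, f x ^ 2 :=
    Equiv.sum_comp (tshift N (unitVec μ)) (fun x => f x ^ 2)
  have h1 : ∑ x, f x * (2 * f x - f (tshift N (unitVec μ) x) - f (tshift N (-unitVec μ) x))
      = 2 * ∑ x, f x ^ 2 - ∑ x, f x * f (tshift N (unitVec μ) x) - ∑ x, f x * f (tshift N (-unitVec μ) x) := by
    rw [Finset.mul_sum, ← Finset.sum_sub_distrib, ← Finset.sum_sub_distrib]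
    refine Finset.sum_congr rfl fun x _ => ?_; ring
  have h2 : ∑ x, (f x - f (tshift N (unitVec μ) x)) ^ 2
      = ∑ x, f x ^ 2 - 2 * ∑ x, f x * f (tshift N (unitVec μ) x) + ∑ x, f (tshift N (unitVec μ) x) ^ 2 := by
    rw [Finset.mul_sum, ← Finset.sum_sub_distrib, ← Finset.sum_add_distrib]
    refine Finset.sum_congr rfl fun x _ => ?_; ring
  rw [h1, h2, hre, hsq]
  have : ∑ x, f (tshift N (unitVec μ) x) * f x = ∑ x, f x * f (tshift N (unitVec μ) x) :=
    Finset.sum_congr rfl fun x _ => mul_comm _ _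
  rw [this]; ring

/-- the form of `−Δ^{per}` is nonnegative. [cite: Balaban1983RegularityDecay, (1.3) p.572, dictionary] -/
theorem perLapT_form_nonneg (f : ↥(boxDom N) → ℝ) : 0 ≤ f ⬝ᵥ perLapT N *ᵥ f := by
  rw [perLapT_form]
  exact Finset.sum_nonneg fun μ _ => Finset.sum_nonneg fun x _ => sq_nonneg _

/-- **`−Δ^{per}` IS TRANSLATION INVARIANT**: its entries at `(σ_t x, σ_t y)` are its entries at `(x, y)`. [cite: Balaban1983RegularityDecay, p.572 («a torus T_η … with periodic conditions»), dictionary] -/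
theorem perLapT_tshift (t : Fin (d + 1) → ℤ) (x y : ↥(boxDom N)) :
    perLapT N (tshift N t x) (tshift N t y) = perLapT N x y := by
  have hS : ∀ v, shiftMat N v (tshift N t x) (tshift N t y) = shiftMat N v x y := by
    intro v
    simp only [shiftMat]
    have h : (tshift N t y = tshift N v (tshift N t x)) ↔ (y = tshift N v x) := by
      rw [tshift_tshift]
      constructor
      · intro h
        have := congrArg (tshift N (-t)) h
        rwa [tshift_tshift, tshift_tshift, add_neg_cancel, tshift_zero,
          show t + v + -t = v by abel] at this
      · intro h
        rw [h, tshift_tshift, show v + t = t + v from add_comm v t]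
    by_cases hc : y = tshift N v x
    · rw [if_pos hc, if_pos (h.2 hc)]
    · rw [if_neg hc, if_neg (fun h' => hc (h.1 h'))]
  have h1 : (1 : Matrix ↥(boxDom N) ↥(boxDom N) ℝ) (tshift N t x) (tshift N t y) = (1 : Matrix _ _ ℝ) x y := by
    simp only [Matrix.one_apply, (tshift N t).injective.eq_iff]
  unfold perLapT
  rw [Matrix.sum_apply, Matrix.sum_apply]
  refine Finset.sum_congr rfl fun μ _ => ?_
  simp only [Matrix.sub_apply, Matrix.smul_apply, hS, h1]

/-! ### The seam: `−Δ^{per}` agrees with the Neumann Laplacian of the fundamental box off the walls -/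

/-- interior sites of the fundamental box: every coordinate at least one step away from both walls. [cite: Balaban1983RegularityDecay, p.572 («a torus T_η … with periodic conditions»), dictionary] -/
def Interior (x : ↥(boxDom N)) : Prop := ∀ i, 1 ≤ x.1 i ∧ x.1 i + 2 ≤ N i

variable {N}

/-- at an interior site the forward torus neighbour is the lattice neighbour. [cite: Balaban1983RegularityDecay, p.572 («a torus T_η … with periodic conditions»), dictionary] -/
theorem tshift_unitVec_of_interior {x : ↥(boxDom N)} (hx : Interior N x) (μ : Fin (d + 1)) :
    (tshift N (unitVec μ) x).1 = x.1 + Pi.single μ 1 := by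
  refine tshift_val_of_mem (mem_boxDom.2 fun i => ?_)
  have h := (mem_boxDom.1 x.2) i
  have hi := hx i
  by_cases hiμ : i = μ
  · subst hiμ; simp only [unitVec, Pi.add_apply, Pi.single_eq_same]; omega
  · simp only [unitVec, Pi.add_apply, Pi.single_eq_of_ne hiμ, add_zero]; exact h

/-- at an interior site the backward torus neighbour is the lattice neighbour. [cite: Balaban1983RegularityDecay, p.572 («a torus T_η … with periodic conditions»), dictionary] -/
theorem tshift_neg_unitVec_of_interior {x : ↥(boxDom N)} (hx : Interior N x) (μ : Fin (d + 1)) :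
    (tshift N (-unitVec μ) x).1 = x.1 - Pi.single μ 1 := by
  rw [sub_eq_add_neg]
  refine tshift_val_of_mem (mem_boxDom.2 fun i => ?_)
  have h := (mem_boxDom.1 x.2) i
  have hi := hx i
  by_cases hiμ : i = μ
  · subst hiμ; simp only [unitVec, Pi.add_apply, Pi.neg_apply, Pi.single_eq_same]; omega
  · simp only [unitVec, Pi.add_apply, Pi.neg_apply, Pi.single_eq_of_ne hiμ, neg_zero, add_zero]; exact h

/-- `x + e_i = x + e_μ` forces `i = μ`. [folklore] -/
private theorem single_idx_eq {x : Fin (d + 1) → ℤ} {i μ : Fin (d + 1)}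
    (h : x + Pi.single i (1 : ℤ) = x + Pi.single μ 1) : i = μ := by
  by_contra hne
  have := congrFun (add_left_cancel h) i
  rw [Pi.single_eq_same, Pi.single_eq_of_ne hne] at this
  exact one_ne_zero this

/-- `x − e_i = x − e_μ` forces `i = μ`. [folklore] -/
private theorem single_idx_eq' {x : Fin (d + 1) → ℤ} {i μ : Fin (d + 1)}
    (h : x - Pi.single i (1 : ℤ) = x - Pi.single μ 1) : i = μ := by
  by_contra hne
  have := congrFun (sub_right_inj.1 h) i
  rw [Pi.single_eq_same, Pi.single_eq_of_ne hne] at this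
  exact one_ne_zero this

/-- `x + e_i ≠ x − e_μ`. [folklore] -/
private theorem add_single_ne_sub_single (x : Fin (d + 1) → ℤ) (i μ : Fin (d + 1)) :
    x + Pi.single i (1 : ℤ) ≠ x - Pi.single μ 1 := by
  intro h
  have h' : (Pi.single i (1 : ℤ) : Fin (d + 1) → ℤ) = -(Pi.single μ (1 : ℤ) : Fin (d + 1) → ℤ) := by
    have h2 : x + Pi.single i (1 : ℤ) = x + -(Pi.single μ (1 : ℤ) : Fin (d + 1) → ℤ) := by
      rw [h, sub_eq_add_neg]
    exact add_left_cancel h2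
  have := congrFun h' i
  rw [Pi.single_eq_same, Pi.neg_apply] at this
  by_cases hiμ : i = μ
  · subst hiμ; rw [Pi.single_eq_same] at this; omega
  · rw [Pi.single_eq_of_ne hiμ] at this; omega

/-- **OFF THE WALLS `−Δ^{per}` IS THE NEUMANN LAPLACIAN OF THE FUNDAMENTAL BOX**: at an interior row the entries agree
(`2(d+1)` on the diagonal, `−1` on the `2(d+1)` lattice neighbours). [cite: Balaban1983RegularityDecay, p.572 («a torus T_η … with periodic conditions»), dictionary] -/
theorem perLapT_apply_of_interior {x : ↥(boxDom N)} (hx : Interior N x) (y : ↥(boxDom N)) :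
    perLapT N x y = neumannLapK N x.1 y.1 := by
  classical
  -- the indicators of the torus neighbours are the indicators of the lattice neighbours
  have hfw : ∀ μ, (y = tshift N (unitVec μ) x) ↔ (y.1 = x.1 + Pi.single μ 1) := fun μ => by
    rw [Subtype.ext_iff, tshift_unitVec_of_interior hx μ]
  have hbw : ∀ μ, (y = tshift N (-unitVec μ) x) ↔ (y.1 = x.1 - Pi.single μ 1) := fun μ => by
    rw [Subtype.ext_iff, tshift_neg_unitVec_of_interior hx μ]
  have hentry : perLapT N x y = ∑ μ : Fin (d + 1), ((2 : ℝ) * (if x = y then 1 else 0)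
      - (if y.1 = x.1 + Pi.single μ 1 then 1 else 0) - (if y.1 = x.1 - Pi.single μ 1 then 1 else 0)) := by
    unfold perLapT
    rw [Matrix.sum_apply]
    refine Finset.sum_congr rfl fun μ _ => ?_
    simp only [Matrix.sub_apply, Matrix.smul_apply, Matrix.one_apply, shiftMat, smul_eq_mul, hfw μ, hbw μ]
  rw [hentry]
  -- all lattice neighbours of an interior site lie in the box
  have hnb : ∀ z ∈ nbrs x.1, z ∈ boxDom N := by
    intro z hz
    obtain ⟨i, rfl | rfl⟩ := mem_nbrs.1 hz
    · rw [← tshift_unitVec_of_interior hx i]; exact (tshift N (unitVec i) x).2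
    · rw [← tshift_neg_unitVec_of_interior hx i]; exact (tshift N (-unitVec i) x).2
  by_cases hyx : x = y
  · -- diagonal
    subst hyx
    have hne1 : ∀ μ, ¬ (x.1 = x.1 + Pi.single μ (1 : ℤ)) := fun μ h => by
      have := congrFun h μ; simp only [Pi.add_apply, Pi.single_eq_same] at this; omega
    have hne2 : ∀ μ, ¬ (x.1 = x.1 - Pi.single μ (1 : ℤ)) := fun μ h => by
      have := congrFun h μ; simp only [Pi.sub_apply, Pi.single_eq_same] at this; omega
    simp only [if_true, hne1, hne2, if_false, sub_zero, mul_one, Finset.sum_const, Finset.card_univ,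
      Fintype.card_fin, nsmul_eq_mul]
    unfold neumannLapK
    rw [if_pos rfl, Finset.filter_true_of_mem hnb, card_nbrs]
    push_cast; ring
  · have hyx1 : y.1 ≠ x.1 := fun h => hyx (Subtype.ext h).symm
    simp only [if_neg hyx, mul_zero, zero_sub]
    unfold neumannLapK
    rw [if_neg hyx1]
    by_cases hmem : y.1 ∈ nbrs x.1
    · rw [if_pos hmem]
      obtain ⟨i, hi | hi⟩ := mem_nbrs.1 hmem
      · -- `y = x + e_i`: only the forward indicator of direction `i` fires
        have hf : ∀ μ, (if y.1 = x.1 + Pi.single μ 1 then (1 : ℝ) else 0) = if μ = i then 1 else 0 := by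
          intro μ
          by_cases hμ : μ = i
          · subst hμ; rw [if_pos hi, if_pos rfl]
          · rw [if_neg, if_neg hμ]; intro h; rw [hi] at h; exact hμ (single_idx_eq h).symm
        have hb : ∀ μ, (if y.1 = x.1 - Pi.single μ 1 then (1 : ℝ) else 0) = 0 := by
          intro μ; rw [if_neg]; intro h; rw [hi] at h; exact add_single_ne_sub_single x.1 i μ h
        simp [hf, hb]
      · have hf : ∀ μ, (if y.1 = x.1 + Pi.single μ 1 then (1 : ℝ) else 0) = 0 := by
          intro μ; rw [if_neg]; intro h; rw [hi] at h; exact add_single_ne_sub_single x.1 μ i h.symm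
        have hb : ∀ μ, (if y.1 = x.1 - Pi.single μ 1 then (1 : ℝ) else 0) = if μ = i then 1 else 0 := by
          intro μ
          by_cases hμ : μ = i
          · subst hμ; rw [if_pos hi, if_pos rfl]
          · rw [if_neg, if_neg hμ]; intro h; rw [hi] at h; exact hμ (single_idx_eq' h).symm
        simp [hf, hb]
    · rw [if_neg hmem]
      have hf : ∀ μ, (if y.1 = x.1 + Pi.single μ 1 then (1 : ℝ) else 0) = 0 := by
        intro μ; rw [if_neg]; intro h; exact hmem (mem_nbrs.2 ⟨μ, Or.inl h⟩)
      have hb : ∀ μ, (if y.1 = x.1 - Pi.single μ 1 then (1 : ℝ) else 0) = 0 := by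
        intro μ; rw [if_neg]; intro h; exact hmem (mem_nbrs.2 ⟨μ, Or.inr h⟩)
      simp [hf, hb]

variable (N)

/-- the Laplacian piece of the box lineage: `opBoxR 1 0 0 1 N = −Δ^N`. [cite: Balaban1983RegularityDecay, p.572 («a torus T_η … with periodic conditions»), dictionary] -/
theorem opBoxR_lap_apply (x y : ↥(boxDom N)) : opBoxR 1 0 0 1 N x y = neumannLapK N x.1 y.1 := by
  simp [opBoxR, B4BoxCov237.opBoxR, diagK, avgK]

/-- **THE SEAM MATRIX** `−Δ^{per} − (−Δ^N)`: the bonds of the torus across the walls of the fundamental box (it turns the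
Neumann box of the lineage into print's torus). [cite: Balaban1983RegularityDecay, p.572 («periodic conditions»), dictionary] -/
def seamT : Matrix ↥(boxDom N) ↥(boxDom N) ℝ := perLapT N - opBoxR 1 0 0 1 N

/-- the seam matrix is symmetric. [cite: Balaban1983RegularityDecay, p.572 («a torus T_η … with periodic conditions»), dictionary] -/
theorem seamT_isSymm : (seamT N).IsSymm := by
  unfold seamT Matrix.IsSymm
  rw [Matrix.transpose_sub, (perLapT_isSymm N).eq, (opBoxR_isSymm _ _ _ _ _).eq]

variable {N}

/-- **THE SEAM LIVES ON THE WALLS** (rows): an interior row of the seam matrix vanishes. [cite: Balaban1983RegularityDecay, p.572 («a torus T_η … with periodic conditions»), dictionary] -/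
theorem seamT_apply_of_interior_left {x : ↥(boxDom N)} (hx : Interior N x) (y : ↥(boxDom N)) : seamT N x y = 0 := by
  unfold seamT
  rw [Matrix.sub_apply, perLapT_apply_of_interior hx, opBoxR_lap_apply, sub_self]

/-- **THE SEAM LIVES ON THE WALLS** (columns). [cite: Balaban1983RegularityDecay, p.572 («a torus T_η … with periodic conditions»), dictionary] -/
theorem seamT_apply_of_interior_right (x : ↥(boxDom N)) {y : ↥(boxDom N)} (hy : Interior N y) : seamT N x y = 0 := by
  have h := (seamT_isSymm N).apply x y
  rw [← h]
  exact seamT_apply_of_interior_left hy x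

/-- a matrix whose wall rows vanish is annihilated by the seam on the left. [cite: Balaban1983RegularityDecay, p.572 («a torus T_η … with periodic conditions»), dictionary] -/
theorem seamT_mul_eq_zero {A : Matrix ↥(boxDom N) ↥(boxDom N) ℝ} (hA : ∀ w, ¬ Interior N w → ∀ y, A w y = 0) :
    seamT N * A = 0 := by
  ext x y
  rw [Matrix.mul_apply, Matrix.zero_apply]
  refine Finset.sum_eq_zero fun w _ => ?_
  by_cases hw : Interior N w
  · rw [seamT_apply_of_interior_right x hw, zero_mul]
  · rw [hA w hw y, mul_zero]

end PerLap

/-! ## §3 Block arithmetic of torus translations by multiples of the block sizes -/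

section BlockArith

/-- `((x + bτ) mod bν) div b = (x div b + τ) mod ν` (`b, ν ≥ 1`): translating by a multiple of the block size and reducing
modulo a multiple of the block size acts on BLOCK INDICES. [cite: Balaban1983RegularityDecay, p.572 («a torus T_η … with periodic conditions»), dictionary] -/
theorem emod_mul_ediv {b ν : ℕ} (hb : 1 ≤ b) (hν : 1 ≤ ν) (x τ : ℤ) :
    (x + b * τ) % ((b * ν : ℕ) : ℤ) / b = (x / b + τ) % ν := by
  have hb0 : (0 : ℤ) < b := by exact_mod_cast hb
  have hν0 : (0 : ℤ) < ν := by exact_mod_cast hν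
  have hbν : ((b * ν : ℕ) : ℤ) = (b : ℤ) * ν := by push_cast; ring
  set q := x / b with hq
  set r := x % b with hr
  have hx : x = b * q + r := (Int.mul_ediv_add_emod x b).symm
  have hr0 : 0 ≤ r := Int.emod_nonneg _ hb0.ne'
  have hr1 : r < b := Int.emod_lt_of_pos _ hb0
  set m := (q + τ) % ν with hm
  have hm0 : 0 ≤ m := Int.emod_nonneg _ hν0.ne'
  have hm1 : m < ν := Int.emod_lt_of_pos _ hν0
  have hqt : q + τ = ν * ((q + τ) / ν) + m := (Int.mul_ediv_add_emod (q + τ) ν).symm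
  have hdec : x + b * τ = (b * m + r) + ((b : ℤ) * ν) * ((q + τ) / ν) := by
    have e1 : x + b * τ = b * (q + τ) + r := by rw [hx]; ring
    rw [e1]
    set w := (q + τ) / ν with hw
    rw [hqt]; ring
  have hlo : 0 ≤ (b : ℤ) * m + r := by positivity
  have hhi : (b : ℤ) * m + r < (b : ℤ) * ν := by
    have : (b : ℤ) * m ≤ (b : ℤ) * (ν - 1) := mul_le_mul_of_nonneg_left (by omega) hb0.le
    nlinarith
  rw [hbν, hdec, Int.add_mul_emod_self_left, Int.emod_eq_of_lt hlo hhi]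
  rw [show (b : ℤ) * m + r = r + b * m by ring, Int.add_mul_ediv_left _ _ hb0.ne', Int.ediv_eq_zero_of_lt hr0 hr1,
    zero_add]

/-- **BLOCK INDICES UNDER A TORUS TRANSLATION BY A MULTIPLE OF THE BLOCK SIZE**: for `b ∣ t_i`, `N_i = bν_i`, the block of
`(x + t) mod N` in direction `i` is `(blk x_i + t_i/b) mod ν_i`. [cite: Balaban1983RegularityDecay, p.572 («a torus T_η … with periodic conditions»), dictionary] -/
theorem blk_twrap_add {b : ℕ} (hb : 1 ≤ b) {N : Fin (d + 1) → ℕ} {ν : Fin (d + 1) → ℕ} (hN : ∀ i, N i = b * ν i)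
    (hν : ∀ i, 1 ≤ ν i) {t τ : Fin (d + 1) → ℤ} (ht : ∀ i, t i = b * τ i) (x : Fin (d + 1) → ℤ) (i : Fin (d + 1)) :
    blk b (twrap N (x + t)) i = (blk b x i + τ i) % ν i := by
  simp only [blk, twrap, Pi.add_apply, hN i, ht i]
  exact emod_mul_ediv hb (hν i) _ _

/-- hence sites in one `b`-block are translated into one `b`-block. [cite: Balaban1983RegularityDecay, p.572 («a torus T_η … with periodic conditions»), dictionary] -/
theorem blk_twrap_add_eq {b : ℕ} (hb : 1 ≤ b) {N : Fin (d + 1) → ℕ} {ν : Fin (d + 1) → ℕ} (hN : ∀ i, N i = b * ν i)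
    (hν : ∀ i, 1 ≤ ν i) {t τ : Fin (d + 1) → ℤ} (ht : ∀ i, t i = b * τ i) {x x' : Fin (d + 1) → ℤ}
    (h : blk b x' = blk b x) : blk b (twrap N (x' + t)) = blk b (twrap N (x + t)) := by
  funext i
  rw [blk_twrap_add hb hN hν ht, blk_twrap_add hb hN hν ht, show blk b x' i = blk b x i from congrFun h i]

/-- … and conversely, for sites of the box (apply the previous lemma to the inverse translation). [cite: Balaban1983RegularityDecay, p.572 («a torus T_η … with periodic conditions»), dictionary] -/
theorem blk_tshift_eq_iff {b : ℕ} (hb : 1 ≤ b) {N : Fin (d + 1) → ℕ} {ν : Fin (d + 1) → ℕ} (hN : ∀ i, N i = b * ν i)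
    (hν : ∀ i, 1 ≤ ν i) {t τ : Fin (d + 1) → ℤ} (ht : ∀ i, t i = b * τ i) (x x' : ↥(boxDom N)) :
    blk b (tshift N t x').1 = blk b (tshift N t x).1 ↔ blk b x'.1 = blk b x.1 := by
  constructor
  · intro h
    have h' := blk_twrap_add_eq hb hN hν (t := -t) (τ := -τ) (fun i => by rw [Pi.neg_apply, ht i, Pi.neg_apply]; ring) h
    have e1 : twrap N ((tshift N t x').1 + -t) = x'.1 := by
      rw [tshift_val, twrap_twrap_add, ← sub_eq_add_neg, add_sub_cancel_right, twrap_eq_self x'.2]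
    have e2 : twrap N ((tshift N t x).1 + -t) = x.1 := by
      rw [tshift_val, twrap_twrap_add, ← sub_eq_add_neg, add_sub_cancel_right, twrap_eq_self x.2]
    rwa [e1, e2] at h'
  · intro h
    rw [tshift_val, tshift_val]
    exact blk_twrap_add_eq hb hN hν ht h

end BlockArith

/-! ## §4 (2.1)–(2.4) on the torus `T_η`: the level function of a nested family of block-union domains -/

/-- the side of the top big blocks `M·L^k = M_h·L^{k+1}` divides the torus side: `N₀_μ = (M·L^k)·P_μ`. [cite: Balaban1984PropagatorsII, (2.1) p.224, dictionary] -/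
theorem N0_eq_bigSide_mul (ℓ Mh k : ℕ) (P : Fin (d + 1) → ℕ) (i : Fin (d + 1)) :
    N0 ℓ Mh k P i = bigSide ℓ Mh k * P i := by
  simp only [N0, bigSide, pow_succ]; ring

/-- `N₀ ≥ 1` for `M_h ≥ 1`, `P ≥ 1`. [cite: Balaban1984PropagatorsII, (2.1) p.224, dictionary] -/
theorem one_le_N0 {ℓ Mh k : ℕ} {P : Fin (d + 1) → ℕ} (hMh : 1 ≤ Mh) (hP : ∀ i, 1 ≤ P i) (i : Fin (d + 1)) :
    1 ≤ N0 ℓ Mh k P i := by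
  rw [N0_eq_bigSide_mul]; exact Nat.one_le_iff_ne_zero.2 (Nat.mul_ne_zero_iff.2 ⟨by have := one_le_bigSide (ℓ := ℓ) hMh k; omega, by have := hP i; omega⟩)

/-- **(2.1)–(2.2) ON THE TORUS `T_η`** (levels `1, …, k`, `Ω₁ = T_η` — print: «we admit the case when some domains Ω_j are
equal to T_η»): the LEVEL FUNCTION `lev` on the fundamental box `Π_μ[0, N₀_μ)` of the torus (`x ∈ B^j(Λ_j) ⇔ lev x = j`,
(2.3)–(2.4) built in), **(2.1)** «Ω_j^{(j)} is a sum of big blocks» (membership in `Ω_j = {j ≤ lev}` depends only on the big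
`j`-block, which is a block of the torus since `M·L^j ∣ N₀`), **(2.2)** «(L^jη)^{−1}dist(Ω_j^c, Ω_{j+1}) > RM» with the distance
of the TORUS (sup-distance of `Π_μ ℤ/N₀_μ`, `torusSupNorm`). [cite: Balaban1984PropagatorsII, (2.1)–(2.4) p.224] -/
structure TDomains (d ℓ Mh k : ℕ) (P : Fin (d + 1) → ℕ) (R : ℕ) where
  /-- the level of (the territory `B^j(Λ_j)` containing) a site of the torus -/
  lev : (Fin (d + 1) → ℤ) → ℕ
  one_le_lev : ∀ x, 1 ≤ lev x
  lev_le : ∀ x, lev x ≤ k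
  /-- (2.1): `Ω_j = {j ≤ lev}` is a union of big `j`-blocks, `2 ≤ j` -/
  bigBlocks : ∀ j, 2 ≤ j → ∀ x ∈ boxDom (N0 ℓ Mh k P), ∀ x' ∈ boxDom (N0 ℓ Mh k P),
    blk (bigSide ℓ Mh j) x' = blk (bigSide ℓ Mh j) x → (j ≤ lev x ↔ j ≤ lev x')
  /-- (2.2) with the torus distance: `dist_T(Ω_j^c, Ω_{j+1}) > R·M·L^j` -/
  sepT : ∀ j, ∀ x ∈ boxDom (N0 ℓ Mh k P), ∀ x' ∈ boxDom (N0 ℓ Mh k P), lev x < j → j + 1 ≤ lev x' →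
    ((R * bigSide ℓ Mh j : ℕ) : ℝ) < torusSupNorm (N0 ℓ Mh k P) (x - x')

namespace TDomains

variable {ℓ Mh k R : ℕ} {P : Fin (d + 1) → ℕ} (D : TDomains d ℓ Mh k P R)

/-- **A TORUS FAMILY IS A BOX FAMILY OF THE FUNDAMENTAL BOX** (same level function): the torus distance is at most the
lattice distance of the representatives, so (2.2) on the torus implies (2.2) on the box — every theorem of the box lineage
applies to `D.toDomains`. [cite: Balaban1984PropagatorsII, (2.1)–(2.2) p.224, dictionary] -/
def toDomains : Domains d ℓ Mh k P R where
  lev := D.lev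
  one_le_lev := D.one_le_lev
  lev_le := D.lev_le
  bigBlocks := D.bigBlocks
  sep := fun j x hx x' hx' h1 h2 =>
    lt_of_lt_of_le (D.sepT j x hx x' hx' h1 h2) (torusSupNorm_le_supNorm (one_le_of_mem hx) _)

/-- the level function of the box family is the torus level function. [cite: Balaban1984PropagatorsII, (2.3)–(2.4) p.224] -/
@[simp] theorem toDomains_lev : D.toDomains.lev = D.lev := rfl

/-- **THE TRIVIAL MEMBER** `Ω₁ = … = Ω_k = T_η`: the structure is inhabited. [cite: Balaban1984PropagatorsII, (2.1) p.224 («Ω_j = T_η for j = 1, 2, …»)] -/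
def top (d ℓ Mh k : ℕ) (P : Fin (d + 1) → ℕ) (R : ℕ) (hk : 1 ≤ k) : TDomains d ℓ Mh k P R where
  lev := fun _ => k
  one_le_lev := fun _ => hk
  lev_le := fun _ => le_rfl
  bigBlocks := fun _ _ _ _ _ _ _ => Iff.rfl
  sepT := fun j x _ x' _ (h1 : k < j) (h2 : j + 1 ≤ k) => by exfalso; omega

/-- the translation vector of the chart `s`: `(M·L^k)·s`, a multiple of every block size `L^j`, `M·L^j`, `j ≤ k`.
[cite: Balaban1984PropagatorsII, (2.1) p.224, dictionary] -/
def tvec (ℓ Mh k : ℕ) (s : Fin (d + 1) → ℤ) : Fin (d + 1) → ℤ := fun i => (bigSide ℓ Mh k : ℤ) * s i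

/-- `M·L^j ∣ M·L^k` for `j ≤ k`. [cite: Balaban1984PropagatorsII, (2.1) p.224, dictionary] -/
theorem bigSide_dvd {j : ℕ} (hjk : j ≤ k) : bigSide ℓ Mh j ∣ bigSide ℓ Mh k := by
  obtain ⟨s, rfl⟩ := Nat.exists_eq_add_of_le hjk
  exact ⟨(ℓ + 1) ^ s, by unfold bigSide; rw [pow_add, pow_add]; ring⟩

/-- `L^j ∣ M·L^k` for `j ≤ k + 1`. [cite: Balaban1984PropagatorsII, (2.1) p.224, dictionary] -/
theorem pow_dvd_bigSide {j : ℕ} (hjk : j ≤ k + 1) : (ℓ + 1) ^ j ∣ bigSide ℓ Mh k := by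
  obtain ⟨s, hs⟩ := Nat.exists_eq_add_of_le hjk
  exact ⟨Mh * (ℓ + 1) ^ s, by unfold bigSide; rw [hs, pow_add]; ring⟩

/-- **THE CHART `s`** (a torus translation by `(M·L^k)·s`): the translated level function `x ↦ lev((x + (M·L^k)s) mod N₀)`
is again a torus family — big blocks go to big blocks, torus distances are preserved. [cite: Balaban1984PropagatorsII, (2.1)–(2.2) p.224, dictionary] -/
def chart (s : Fin (d + 1) → ℤ) : TDomains d ℓ Mh k P R where
  lev := fun x => D.lev (twrap (N0 ℓ Mh k P) (x + tvec ℓ Mh k s))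
  one_le_lev := fun _ => D.one_le_lev _
  lev_le := fun _ => D.lev_le _
  bigBlocks := by
    intro j hj x hx x' hx' hblk
    by_cases hjk : j ≤ k
    · have hN1 : ∀ i, 1 ≤ N0 ℓ Mh k P i := fun i => one_le_of_mem hx i
      obtain ⟨c, hc⟩ := bigSide_dvd (ℓ := ℓ) (Mh := Mh) hjk
      have hb : 1 ≤ bigSide ℓ Mh j := by
        have := hN1 0; rw [N0_eq_bigSide_mul, hc] at this
        exact Nat.one_le_iff_ne_zero.2 fun h => by rw [h] at this; simp at this
      have hνpos : ∀ i, 1 ≤ c * P i := fun i => by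
        have := hN1 i; rw [N0_eq_bigSide_mul, hc, mul_assoc] at this
        exact Nat.one_le_iff_ne_zero.2 fun h => by rw [h] at this; simp at this
      have key := blk_twrap_add_eq hb (N := N0 ℓ Mh k P) (ν := fun i => c * P i)
        (fun i => by rw [N0_eq_bigSide_mul, hc, mul_assoc]) hνpos (t := tvec ℓ Mh k s)
        (τ := fun i => (c : ℤ) * s i) (fun i => by simp only [tvec, hc]; push_cast; ring) hblk
      exact D.bigBlocks j hj _ (twrap_mem hN1 _) _ (twrap_mem hN1 _) key
    · constructor <;> intro h
      · exact absurd (h.trans (D.lev_le _)) hjk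
      · exact absurd (h.trans (D.lev_le _)) hjk
  sepT := by
    intro j x hx x' hx' h1 h2
    have hN1 : ∀ i, 1 ≤ N0 ℓ Mh k P i := fun i => one_le_of_mem hx i
    have h := D.sepT j _ (twrap_mem hN1 (x + tvec ℓ Mh k s)) _ (twrap_mem hN1 (x' + tvec ℓ Mh k s)) h1 h2
    have e := torusSupNorm_tshift_sub (N0 ℓ Mh k P) (tvec ℓ Mh k s) ⟨x, hx⟩ ⟨x', hx'⟩
    rw [tshift_val, tshift_val] at e
    rwa [e] at h

/-- the chart's level at `x` is the level at the translated site `σ_s x`. [cite: Balaban1984PropagatorsII, (2.3)–(2.4) p.224, dictionary] -/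
theorem chart_lev (s : Fin (d + 1) → ℤ) (x : ↥(boxDom (N0 ℓ Mh k P))) :
    (D.chart s).lev x.1 = D.lev (tshift (N0 ℓ Mh k P) (tvec ℓ Mh k s) x).1 := rfl

/-- the chart `0` has the original level function on the box. [cite: Balaban1984PropagatorsII, (2.3)–(2.4) p.224, dictionary] -/
theorem chart_zero_lev (x : ↥(boxDom (N0 ℓ Mh k P))) : (D.chart 0).lev x.1 = D.lev x.1 := by
  rw [chart_lev]
  have : tvec ℓ Mh k (0 : Fin (d + 1) → ℤ) = 0 := funext fun i => by simp [tvec]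
  rw [this, tshift_zero]

/-- two sites of the torus in one `L^{lev x}`-block have the same level (territories are unions of blocks of their own
level; inherited from the box lineage). [cite: Balaban1984PropagatorsII, (2.1)+(2.3) p.224] -/
theorem lev_eq_of_blk_eq {x x' : Fin (d + 1) → ℤ} (hx : x ∈ boxDom (N0 ℓ Mh k P)) (hx' : x' ∈ boxDom (N0 ℓ Mh k P))
    (h : blk ((ℓ + 1) ^ D.lev x) x' = blk ((ℓ + 1) ^ D.lev x) x) : D.lev x' = D.lev x :=
  D.toDomains.lev_eq_of_blk_eq hx hx' h

end TDomains

/-! ## §5 The `k`-level operator `Δ′_a` (2.13)–(2.14) ON THE TORUS and its inverse `G′` -/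

/-- **THE GENUINE `k`-LEVEL OPERATOR `Δ′_a = −Δ^{per} + Σ_{j=1}^{k} a_j(L^j)^{−2}Q′_j*1_{Λ_j}Q′_j` OF (2.13)–(2.14) ON THE
TORUS `T_η`** (fundamental box `Π_μ[0, N_μ)`, lattice units): the box operator of the lineage plus the seam bonds.
[cite: Balaban1984PropagatorsII, (2.13)–(2.14) p.225] -/
def mlOpT (N : Fin (d + 1) → ℕ) (ℓ k : ℕ) (lev : (Fin (d + 1) → ℤ) → ℕ) (a : ℕ → ℝ) :
    Matrix ↥(boxDom N) ↥(boxDom N) ℝ :=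
  mlOp N ℓ k lev a + seamT N

/-- `Δ′_a = −Δ^{per} + (Δ′_a^{box} − (−Δ^N))`: the periodic Laplacian plus the averaging part of the box operator.
[cite: Balaban1984PropagatorsII, (2.13)–(2.14) p.225, dictionary] -/
theorem mlOpT_eq (N : Fin (d + 1) → ℕ) (ℓ k : ℕ) (lev : (Fin (d + 1) → ℤ) → ℕ) (a : ℕ → ℝ) :
    mlOpT N ℓ k lev a = perLapT N + (mlOp N ℓ k lev a - opBoxR 1 0 0 1 N) := by
  unfold mlOpT seamT; abel

section Apply

variable {ℓ Mh k R : ℕ} {P : Fin (d + 1) → ℕ} (D : TDomains d ℓ Mh k P R)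

/-- **ENTRIES OF `Δ′_a` ON THE TORUS**: `Δ′_a(x, x′) = (−Δ^{per})(x, x′) + levC_{lev x}·[x′ ∼_{lev x} x]`.
[cite: Balaban1984PropagatorsII, (2.13)–(2.14) p.225] -/
theorem mlOpT_apply {N : Fin (d + 1) → ℕ} (hN : N = N0 ℓ Mh k P) (a : ℕ → ℝ) (x y : ↥(boxDom N)) :
    mlOpT N ℓ k D.lev a x y
      = perLapT N x y + avgK (levC d ℓ a (D.lev x.1)) ((ℓ + 1) ^ D.lev x.1) x.1 y.1 := by
  unfold mlOpT seamT
  rw [Matrix.add_apply, Matrix.sub_apply, ← D.toDomains_lev, mlOp_apply D.toDomains hN a x y, opBoxR_lap_apply]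
  ring

end Apply

section Form

variable {N : Fin (d + 1) → ℕ} (ℓ k : ℕ) (lev : (Fin (d + 1) → ℤ) → ℕ) (a : ℕ → ℝ)

/-- `Δ′_a` on the torus is a symmetric matrix. [cite: Balaban1984PropagatorsII, (2.13)–(2.14) p.225 (a quadratic form)] -/
theorem mlOpT_isSymm : (mlOpT N ℓ k lev a).IsSymm := by
  unfold mlOpT
  exact (mlOp_isSymm ℓ k lev a).add (seamT_isSymm N)

/-- **THE QUADRATIC FORM OF `Δ′_a` ON THE TORUS** (2.14):
`⟨v, Δ′_av⟩ = Σ_μ Σ_x (v_x − v_{x+e_μ})² + Σ_{j≤k} levC_j·Σ_{j-blocks β}(Σ_{x∈β, lev x = j} v_x)²` (torus bonds).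
[cite: Balaban1984PropagatorsII, (2.13)–(2.14) p.225] -/
theorem mlOpT_form (v : ↥(boxDom N) → ℝ) :
    v ⬝ᵥ mlOpT N ℓ k lev a *ᵥ v
      = (∑ μ, ∑ x, (v x - v (tshift N (unitVec μ) x)) ^ 2)
        + ∑ j ∈ Finset.range (k + 1), levC d ℓ a j *
            ∑ β ∈ Finset.univ.image (fun x : ↥(boxDom N) => blk ((ℓ + 1) ^ j) x.1),
              (∑ y ∈ Finset.univ.filter (fun y : ↥(boxDom N) => blk ((ℓ + 1) ^ j) y.1 = β),
                indLev N lev j y * v y) ^ 2 := by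
  rw [mlOpT_eq, Matrix.add_mulVec, dotProduct_add, perLapT_form, Matrix.sub_mulVec, dotProduct_sub, mlOp_form,
    quadFormR_eq]
  ring

variable {ℓ k lev a}

/-- **`Δ′_a` IS INJECTIVE ON THE TORUS** («G′ = Δ′_a^{−1} is a well defined, positive operator»): a null vector has zero
torus bond form, hence is constant, and the block form of the territory block of the corner kills the constant.
[cite: Balaban1984PropagatorsII, p.225 («The operator G′ = Δ′_a^{−1} is a well defined, positive operator»)] -/
theorem mlOpT_mulVec_injective (hN : ∀ i, 1 ≤ N i) (hlev : ∀ x, lev x ≤ k) (ha : ∀ j, 0 < a j) :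
    Function.Injective (mlOpT N ℓ k lev a).mulVec := by
  classical
  intro v w hvw
  rw [← sub_eq_zero]
  set u := v - w with hu
  have h0 : mlOpT N ℓ k lev a *ᵥ u = 0 := by rw [hu, Matrix.mulVec_sub, hvw, sub_self]
  have hform := mlOpT_form (N := N) ℓ k lev a u
  rw [h0, dotProduct_zero] at hform
  have hB : 0 ≤ ∑ μ, ∑ x, (u x - u (tshift N (unitVec μ) x)) ^ 2 :=
    Finset.sum_nonneg fun μ _ => Finset.sum_nonneg fun x _ => sq_nonneg _
  have hSj : ∀ j ∈ Finset.range (k + 1), 0 ≤ levC d ℓ a j *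
      ∑ β ∈ Finset.univ.image (fun x : ↥(boxDom N) => blk ((ℓ + 1) ^ j) x.1),
        (∑ y ∈ Finset.univ.filter (fun y : ↥(boxDom N) => blk ((ℓ + 1) ^ j) y.1 = β),
          indLev N lev j y * u y) ^ 2 :=
    fun j _ => mul_nonneg (levC_pos d ℓ (ha j)).le (Finset.sum_nonneg fun β _ => sq_nonneg _)
  have hS := Finset.sum_nonneg hSj
  have hB0 : ∑ μ, ∑ x, (u x - u (tshift N (unitVec μ) x)) ^ 2 = 0 := by linarith
  have hS0 : ∑ j ∈ Finset.range (k + 1), levC d ℓ a j *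
      ∑ β ∈ Finset.univ.image (fun x : ↥(boxDom N) => blk ((ℓ + 1) ^ j) x.1),
        (∑ y ∈ Finset.univ.filter (fun y : ↥(boxDom N) => blk ((ℓ + 1) ^ j) y.1 = β),
          indLev N lev j y * u y) ^ 2 = 0 := by linarith
  -- zero torus bond form: `u` is constant along the torus bonds, in particular along the box bonds
  have htor : ∀ μ x, u x = u (tshift N (unitVec μ) x) := by
    intro μ x
    have h1 := (Finset.sum_eq_zero_iff_of_nonneg fun μ _ =>
      Finset.sum_nonneg fun x _ => sq_nonneg (u x - u (tshift N (unitVec μ) x))).1 hB0 μ (Finset.mem_univ μ)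
    have h2 := (Finset.sum_eq_zero_iff_of_nonneg fun x _ => sq_nonneg (u x - u (tshift N (unitVec μ) x))).1 h1 x
      (Finset.mem_univ x)
    exact sub_eq_zero.1 (pow_eq_zero_iff two_ne_zero |>.1 h2)
  have hbond : ∀ x : ↥(boxDom N), ∀ y ∈ boxNbrs N x, u x = u y := by
    intro x y hy
    have hy' : y.1 ∈ nbrs x.1 := by
      unfold boxNbrs at hy; simpa using hy
    obtain ⟨μ, h | h⟩ := mem_nbrs.1 hy'
    · have hmem : x.1 + unitVec μ ∈ boxDom N := by rw [unitVec, ← h]; exact y.2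
      have e : y = tshift N (unitVec μ) x := Subtype.ext (by rw [tshift_val_of_mem hmem]; exact h)
      rw [e]; exact htor μ x
    · have hxy : x.1 = y.1 + Pi.single μ 1 := by rw [h]; simp
      have hmem : y.1 + unitVec μ ∈ boxDom N := by rw [unitVec, ← hxy]; exact x.2
      have e : x = tshift N (unitVec μ) y := Subtype.ext (by rw [tshift_val_of_mem hmem]; exact hxy)
      rw [e]; exact (htor μ y).symm
  set x₀ : ↥(boxDom N) := ⟨0, zero_mem_boxDom hN⟩ with hx₀
  have hconst : ∀ x : ↥(boxDom N), u x = u x₀ := by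
    intro x
    have hc := box_const_of_bonds hN (u := fun x => (u x : ℂ))
      (fun x y hy => by exact_mod_cast hbond x y hy) x
    exact_mod_cast hc
  -- zero block form at the level of the corner
  set j := lev x₀.1 with hj
  have hjk : j ∈ Finset.range (k + 1) := Finset.mem_range.2 (Nat.lt_succ_of_le (hlev _))
  have hSj0 := (Finset.sum_eq_zero_iff_of_nonneg hSj).1 hS0 j hjk
  have hSj' : ∑ β ∈ Finset.univ.image (fun x : ↥(boxDom N) => blk ((ℓ + 1) ^ j) x.1),
      (∑ y ∈ Finset.univ.filter (fun y : ↥(boxDom N) => blk ((ℓ + 1) ^ j) y.1 = β),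
        indLev N lev j y * u y) ^ 2 = 0 := by
    rcases mul_eq_zero.1 hSj0 with h | h
    · exact absurd h (levC_pos d ℓ (ha j)).ne'
    · exact h
  have hβ := (Finset.sum_eq_zero_iff_of_nonneg fun β _ => sq_nonneg _).1 hSj' (blk ((ℓ + 1) ^ j) x₀.1)
    (Finset.mem_image_of_mem _ (Finset.mem_univ x₀))
  have hsum0 : ∑ y ∈ Finset.univ.filter (fun y : ↥(boxDom N) => blk ((ℓ + 1) ^ j) y.1 = blk ((ℓ + 1) ^ j) x₀.1),
      indLev N lev j y * u y = 0 := pow_eq_zero_iff two_ne_zero |>.1 hβ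
  have hterm : ∀ y ∈ Finset.univ.filter (fun y : ↥(boxDom N) => blk ((ℓ + 1) ^ j) y.1 = blk ((ℓ + 1) ^ j) x₀.1),
      indLev N lev j y * u y = (if lev y.1 = j then 1 else 0) * u x₀ := by
    intro y _
    rw [hconst y]; rfl
  rw [Finset.sum_congr rfl hterm, ← Finset.sum_mul, Finset.sum_boole] at hsum0
  have hmem : x₀ ∈ (Finset.univ.filter (fun y : ↥(boxDom N) => blk ((ℓ + 1) ^ j) y.1 = blk ((ℓ + 1) ^ j) x₀.1)).filter
      (fun y => lev y.1 = j) := by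
    simp [hj]
  have hcard : (((Finset.univ.filter (fun y : ↥(boxDom N) => blk ((ℓ + 1) ^ j) y.1 = blk ((ℓ + 1) ^ j) x₀.1)).filter
      (fun y => lev y.1 = j)).card : ℝ) ≠ 0 := by
    exact_mod_cast Finset.card_ne_zero.2 ⟨x₀, hmem⟩
  have hc : u x₀ = 0 := by
    rcases mul_eq_zero.1 hsum0 with hz | hz
    · exact absurd hz hcard
    · exact hz
  funext x
  rw [hconst x, hc]
  rfl

/-- `Δ′_a` on the torus is a unit of the matrix ring. [cite: Balaban1984PropagatorsII, p.225 («G′ = Δ′_a^{−1} is … well defined»)] -/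
theorem mlOpT_isUnit (hN : ∀ i, 1 ≤ N i) (hlev : ∀ x, lev x ≤ k) (ha : ∀ j, 0 < a j) :
    IsUnit (mlOpT N ℓ k lev a) :=
  Matrix.mulVec_injective_iff_isUnit.1 (mlOpT_mulVec_injective hN hlev ha)

variable (N ℓ k lev a)

/-- **`G′ = Δ′_a^{−1}` ON THE TORUS**, the object of Proposition 2.2 in print's setting `Ω_j ⊂ T_η`.
[cite: Balaban1984PropagatorsII, p.225 («The operator G′ = Δ′_a^{−1}»), Prop. 2.2 p.234] -/
def gmlT : Matrix ↥(boxDom N) ↥(boxDom N) ℝ := (mlOpT N ℓ k lev a)⁻¹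

variable {N ℓ k lev a}

/-- `Δ′_a·G′ = 1` on the torus. [cite: Balaban1984PropagatorsII, p.225 («G′ = Δ′_a^{−1} is a well defined … operator»)] -/
theorem mlOpT_mul_gmlT (hN : ∀ i, 1 ≤ N i) (hlev : ∀ x, lev x ≤ k) (ha : ∀ j, 0 < a j) :
    mlOpT N ℓ k lev a * gmlT N ℓ k lev a = 1 :=
  Matrix.mul_nonsing_inv _ ((Matrix.isUnit_iff_isUnit_det _).1 (mlOpT_isUnit hN hlev ha))

/-- `G′·Δ′_a = 1` on the torus. [cite: Balaban1984PropagatorsII, p.225 («G′ = Δ′_a^{−1} is a well defined … operator»)] -/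
theorem gmlT_mul_mlOpT (hN : ∀ i, 1 ≤ N i) (hlev : ∀ x, lev x ≤ k) (ha : ∀ j, 0 < a j) :
    gmlT N ℓ k lev a * mlOpT N ℓ k lev a = 1 :=
  Matrix.nonsing_inv_mul _ ((Matrix.isUnit_iff_isUnit_det _).1 (mlOpT_isUnit hN hlev ha))

/-- `G′` on the torus is symmetric. [cite: Balaban1984PropagatorsII, p.225 («a well defined, positive operator»)] -/
theorem gmlT_isSymm : (gmlT N ℓ k lev a).IsSymm := by
  unfold gmlT Matrix.IsSymm
  rw [Matrix.transpose_nonsing_inv, (mlOpT_isSymm ℓ k lev a).eq]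

/-- the quadratic form of `Δ′_a` on the torus is nonnegative. [cite: Balaban1984PropagatorsII, (2.13)–(2.14) p.225] -/
theorem mlOpT_form_nonneg (ha : ∀ j, 0 < a j) (v : ↥(boxDom N) → ℝ) : 0 ≤ v ⬝ᵥ mlOpT N ℓ k lev a *ᵥ v := by
  rw [mlOpT_form]
  refine add_nonneg (Finset.sum_nonneg fun μ _ => Finset.sum_nonneg fun x _ => sq_nonneg _)
    (Finset.sum_nonneg fun j _ => ?_)
  exact mul_nonneg (levC_pos d ℓ (ha j)).le (Finset.sum_nonneg fun β _ => sq_nonneg _)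

/-- **`G′` IS POSITIVE ON THE TORUS**: `⟨f, G′f⟩ = ⟨G′f, Δ′_aG′f⟩ ≥ 0`.
[cite: Balaban1984PropagatorsII, p.225 («The operator G′ = Δ′_a^{−1} is a well defined, positive operator»)] -/
theorem gmlT_form_nonneg (hN : ∀ i, 1 ≤ N i) (hlev : ∀ x, lev x ≤ k) (ha : ∀ j, 0 < a j)
    (f : ↥(boxDom N) → ℝ) : 0 ≤ f ⬝ᵥ gmlT N ℓ k lev a *ᵥ f := by
  set g := gmlT N ℓ k lev a *ᵥ f with hg
  have hf : mlOpT N ℓ k lev a *ᵥ g = f := by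
    rw [hg, Matrix.mulVec_mulVec, mlOpT_mul_gmlT hN hlev ha, Matrix.one_mulVec]
  calc (0 : ℝ) ≤ g ⬝ᵥ mlOpT N ℓ k lev a *ᵥ g := mlOpT_form_nonneg ha g
    _ = (mlOpT N ℓ k lev a *ᵥ g) ⬝ᵥ g := dotProduct_comm _ _
    _ = f ⬝ᵥ g := by rw [hf]

end Form

/-! ## §6 The chart identity: the torus operator is the translate of the box operator of the chart, up to the seam -/

section Chart

variable {ℓ Mh k R : ℕ} {P : Fin (d + 1) → ℕ} (D : TDomains d ℓ Mh k P R)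

/-- blocks of level `j ≤ k + 1` are respected by the chart translations: `x′ ∼_j x ⇔ σ_s x′ ∼_j σ_s x`.
[cite: Balaban1984PropagatorsII, (2.1) p.224, dictionary] -/
theorem blk_chart_iff (hMh : 1 ≤ Mh) (hP : ∀ i, 1 ≤ P i) {j : ℕ} (hj : j ≤ k + 1) (s : Fin (d + 1) → ℤ)
    (x x' : ↥(boxDom (N0 ℓ Mh k P))) :
    blk ((ℓ + 1) ^ j) (tshift (N0 ℓ Mh k P) (TDomains.tvec ℓ Mh k s) x').1
        = blk ((ℓ + 1) ^ j) (tshift (N0 ℓ Mh k P) (TDomains.tvec ℓ Mh k s) x).1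
      ↔ blk ((ℓ + 1) ^ j) x'.1 = blk ((ℓ + 1) ^ j) x.1 := by
  obtain ⟨c, hc⟩ := TDomains.pow_dvd_bigSide (ℓ := ℓ) (Mh := Mh) (k := k) hj
  have hb : 1 ≤ (ℓ + 1) ^ j := Nat.one_le_pow _ _ (by omega)
  have hc1 : 1 ≤ c := Nat.one_le_iff_ne_zero.2 fun h => by
    have := one_le_bigSide (ℓ := ℓ) hMh k; rw [hc, h, mul_zero] at this; exact absurd this (by norm_num)
  exact blk_tshift_eq_iff hb (N := N0 ℓ Mh k P) (ν := fun i => c * P i)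
    (fun i => by rw [N0_eq_bigSide_mul, hc, mul_assoc]) (fun i => Nat.mul_le_mul hc1 (hP i))
    (t := TDomains.tvec ℓ Mh k s) (τ := fun i => (c : ℤ) * s i)
    (fun i => by simp only [TDomains.tvec, hc]; push_cast; ring) x x'

/-- **`Δ′_a` ON THE TORUS IS TRANSLATION COVARIANT**: its entries at `(σ_s x, σ_s y)` are the entries at `(x, y)` of the
torus operator of the chart `s` (translated level function). [cite: Balaban1984PropagatorsII, (2.13)–(2.14) p.225, dictionary] -/
theorem mlOpT_tshift (hMh : 1 ≤ Mh) (hP : ∀ i, 1 ≤ P i) (a : ℕ → ℝ) (s : Fin (d + 1) → ℤ)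
    (x y : ↥(boxDom (N0 ℓ Mh k P))) :
    mlOpT (N0 ℓ Mh k P) ℓ k D.lev a (tshift (N0 ℓ Mh k P) (TDomains.tvec ℓ Mh k s) x)
        (tshift (N0 ℓ Mh k P) (TDomains.tvec ℓ Mh k s) y)
      = mlOpT (N0 ℓ Mh k P) ℓ k (D.chart s).lev a x y := by
  rw [mlOpT_apply D rfl, mlOpT_apply (D.chart s) rfl, perLapT_tshift, ← D.chart_lev s x]
  congr 1
  unfold avgK
  have h := blk_chart_iff hMh hP (le_trans ((D.chart s).lev_le x.1) (Nat.le_succ k)) s x y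
  by_cases hc : blk ((ℓ + 1) ^ (D.chart s).lev x.1) y.1 = blk ((ℓ + 1) ^ (D.chart s).lev x.1) x.1
  · rw [if_pos hc, if_pos (h.2 hc)]
  · rw [if_neg hc, if_neg (fun h' => hc (h.1 h'))]

/-- **THE CHART IDENTITY**: `Δ′_a` on the torus is the reindexing, along the torus translation `σ_s`, of the BOX operator
`Δ′_a^{box}` of the chart `s` plus the seam — so that every theorem of the box lineage about `Δ′_a^{box}` of the `Domains`
`(D.chart s).toDomains` is a statement about the torus operator away from the seam. [cite: Balaban1984PropagatorsII, (2.13)–(2.14) p.225, dictionary] -/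
theorem mlOpT_eq_reindex_chart (hMh : 1 ≤ Mh) (hP : ∀ i, 1 ≤ P i) (a : ℕ → ℝ) (s : Fin (d + 1) → ℤ) :
    mlOpT (N0 ℓ Mh k P) ℓ k D.lev a
      = Matrix.reindex (tshift (N0 ℓ Mh k P) (TDomains.tvec ℓ Mh k s)) (tshift (N0 ℓ Mh k P) (TDomains.tvec ℓ Mh k s))
          (mlOp (N0 ℓ Mh k P) ℓ k (D.chart s).toDomains.lev a + seamT (N0 ℓ Mh k P)) := by
  ext i j
  rw [Matrix.reindex_apply, Matrix.submatrix_apply, TDomains.toDomains_lev]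
  have h := mlOpT_tshift D hMh hP a s ((tshift (N0 ℓ Mh k P) (TDomains.tvec ℓ Mh k s)).symm i)
    ((tshift (N0 ℓ Mh k P) (TDomains.tvec ℓ Mh k s)).symm j)
  rw [Equiv.apply_symm_apply, Equiv.apply_symm_apply] at h
  rw [h]
  rfl

/-- **CONSEQUENCE FOR LOCAL TERMS**: if a matrix `A` (in the chart's coordinates) has vanishing wall rows, then
`Δ′_a^{torus}·(σ_s A σ_s⁻¹) = σ_s (Δ′_a^{box,s}·A) σ_s⁻¹` — the seam never sees a term supported off the walls.
[cite: Balaban1984PropagatorsII, (2.38) p.229 with [3] (2.6) p.576, dictionary] -/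
theorem mlOpT_mul_reindex (hMh : 1 ≤ Mh) (hP : ∀ i, 1 ≤ P i) (a : ℕ → ℝ) (s : Fin (d + 1) → ℤ)
    {A : Matrix ↥(boxDom (N0 ℓ Mh k P)) ↥(boxDom (N0 ℓ Mh k P)) ℝ}
    (hA : ∀ w, ¬ Interior (N0 ℓ Mh k P) w → ∀ y, A w y = 0) :
    mlOpT (N0 ℓ Mh k P) ℓ k D.lev a
        * Matrix.reindex (tshift (N0 ℓ Mh k P) (TDomains.tvec ℓ Mh k s)) (tshift (N0 ℓ Mh k P) (TDomains.tvec ℓ Mh k s)) A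
      = Matrix.reindex (tshift (N0 ℓ Mh k P) (TDomains.tvec ℓ Mh k s)) (tshift (N0 ℓ Mh k P) (TDomains.tvec ℓ Mh k s))
          (mlOp (N0 ℓ Mh k P) ℓ k (D.chart s).toDomains.lev a * A) := by
  rw [mlOpT_eq_reindex_chart D hMh hP a s]
  simp only [Matrix.reindex_apply, Matrix.submatrix_mul_equiv, Matrix.add_mul, seamT_mul_eq_zero hA, add_zero]

end Chart

end

end Literature.MathematicalPhysics.QuantumFieldTheory.Balaban1983to89.B6MultiLevelTorusOperator
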